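import Summits.BirchSwinnertonDyer.BirchSwinnertonDyer.Theorems.EisensteinDepletionAtTwoStarOptBNSFKummerFormCore
import HarnessLib

/-!
# The Kummer form on the parity cover (line `nsf` v20, stub S3-U `stub_kummerForm`, crux `StarOptBNSF`, stmt-BirchSwinnertonDyer-27047)

**Stub S3-U CLOSED.**  Data: `W₁/ℚ` with newform `f ∈ S₂(Γ₀(N))`, a period pair `L₁ ⊇ c₁Λ₁(f)` (`c₁ ≠ 0`), a
half-period `λ/2` with `℘_{L₁}(λ/2) − b₂/12 = x₁`, the parity group `Γ′ ≤ Γ₁(N)` (membership: `c₁{∞,γ∞}_f ∈ ℤλ + 2L₁`),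
the Kummer function `g` of stub S3-K (analytic off `L₁`, `g² = ℘_{L₁} − ℘_{L₁}(λ/2)`, `g(w + ℓ) = ±g(w)` with `+` exactly on
`ℤλ + 2L₁`), and cusp forms `G₁, Φ₁ ∈ S_k(Γ₁(N))`, `G₁ ≠ 0`, `Φ₁ = x_{W₁}·G₁` off the poles of
`x_{W₁}(τ) = ℘_{L₁}(c₁u_f(τ)) − b₂/12`.  Claim: there is `h ∈ S_k(Γ′)`, `h ≠ 0`, ANTI-invariant under `Γ₁(N) ∖ Γ′`, with
`h² = (Φ₁ − x₁G₁)·G₁ =: Ψ` on `ℍ`.  The analytic construction (`exists_holomorphic_sqrt`: the meromorphic normal form of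
`g(c₁u_f)·G₁`, its square and its transformation law under `Γ₁(N)`) is the previous file; here: `Γ′`-invariance and
`(Γ₁(N) ∖ Γ′)`-anti-invariance from the sign of `g`, cusp decay from `‖h∣A‖² = ‖(Φ₁ − x₁G₁)∣A‖·‖G₁∣A‖` (Mathlib
`CuspFormClass.zero_at_infty_slash`), and `h ≠ 0`: otherwise `Ψ ≡ 0`, so (`G₁ ≠ 0`, analytic factors on the connected
half-plane) `x_{W₁} ≡ x₁` off the poles, forcing `u_f(τ) ∈ (2c₁)⁻¹L₁` for every `τ` — a countable condition (tree
`countable_setOf_eichlerIntegral_mem_lattice`) on the uncountable `ℍ`.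
Nothing here reads `r_an`; BSD is not proved by this file.
-/

set_option linter.dupNamespace false
set_option autoImplicit false

noncomputable section

open Complex Filter Topology Set Function
open UpperHalfPlane hiding I
open scoped Real Topology Manifold MatrixGroups PeriodPair ModularForm
open ModularForm CongruenceSubgroup

open Literature.NumberTheory.EllipticCurves Literature.NumberTheory.EllipticCurves.ModularForms

namespace Summit.BirchSwinnertonDyer.BirchSwinnertonDyer.Theorems.DepletionAtTwo.KummerForm

/-! ### §5 The stub -/

/-- **Stub S3-U `stub_kummerForm` of line `nsf` v20 (crux `StarOptBNSF`, stmt-BirchSwinnertonDyer-27047), registered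
signature verbatim.**  THE KUMMER FORM ON THE PARITY COVER: with `g` as in S3-K (for `L₁`, `λ`), `G₁, Φ₁` as in S3-X, and
the parity group `Γ′` (membership predicate), the function `h₀(τ) = g(c₁u_f(τ))·G₁(τ)` (off the discrete set where
`c₁u_f(τ) ∈ L₁`) extends to a cusp form `h ∈ S_k(Γ′)`, `h ≠ 0`, ANTI-invariant under `Γ₁(N) ∖ Γ′`, with
`h(τ)² = (Φ₁(τ) − x₁G₁(τ))·G₁(τ)` for all `τ` (§4 + cusp decay §3 + non-vanishing by countability).
[cite: ShimuraIATAF1971, §2.4 and Thm. 7.14] [cite: SilvermanAEC2009, VI.3.6] -/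
theorem stub_kummerForm :
    ∀ (W₁ : WeierstrassCurve ℚ) [W₁.IsElliptic] [W₁.IsGloballyMinimal]
      ⦃N : ℕ⦄ [NeZero N] (f : CuspForm (CongruenceSubgroup.Gamma0 N) 2), IsNewformOf W₁ f →
      ∀ (L₁ : PeriodPair), IsNeronLatticeOf (W₁.baseChange ℂ) L₁ →
      ∀ (c₁ : ℚ), c₁ ≠ 0 → (∀ z ∈ periodLatticeGamma1 f, (c₁ : ℂ) * z ∈ L₁.lattice) →
      ∀ (x₁ : ℚ) (lam : ℂ), lam ∈ L₁.lattice → lam / 2 ∉ L₁.lattice →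
        L₁.weierstrassP (lam / 2) - ((W₁.b₂ : ℚ) : ℂ) / 12 = ((x₁ : ℚ) : ℂ) →
      ∀ (Γ' : Subgroup SL(2, ℤ)),
        (∀ γ : SL(2, ℤ), γ ∈ Γ' ↔ ∃ hγ : γ ∈ CongruenceSubgroup.Gamma0 N, γ ∈ CongruenceSubgroup.Gamma1 N ∧
          ∃ k : ℤ, ∃ w ∈ L₁.lattice, (c₁ : ℂ) * cuspSymbol f ⟨γ, hγ⟩ = (k : ℂ) * lam + 2 * w) →
      ∀ (g : ℂ → ℂ),
        (∀ w : ℂ, w ∉ L₁.lattice → AnalyticAt ℂ g w ∧ g w ^ 2 = L₁.weierstrassP w - L₁.weierstrassP (lam / 2)) →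
        (∀ w ℓ : ℂ, w ∉ L₁.lattice → ℓ ∈ L₁.lattice →
          (∃ k : ℤ, ∃ m ∈ L₁.lattice, ℓ = (k : ℂ) * lam + 2 * m) → g (w + ℓ) = g w) →
        (∀ w ℓ : ℂ, w ∉ L₁.lattice → ℓ ∈ L₁.lattice →
          (¬ ∃ k : ℤ, ∃ m ∈ L₁.lattice, ℓ = (k : ℂ) * lam + 2 * m) → g (w + ℓ) = -g w) →
      ∀ (k : ℤ) (G₁ Φ₁ : CuspForm (CongruenceSubgroup.Gamma1 N) k), (G₁ : UpperHalfPlane → ℂ) ≠ 0 →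
        (∀ τ : UpperHalfPlane, (c₁ : ℂ) * eichlerIntegral f τ ∉ L₁.lattice →
          Φ₁ τ = (L₁.weierstrassP ((c₁ : ℂ) * eichlerIntegral f τ) - ((W₁.b₂ : ℚ) : ℂ) / 12) * G₁ τ) →
      ∃ h : CuspForm Γ' k,
        (h : UpperHalfPlane → ℂ) ≠ 0 ∧
        (∀ γ ∈ CongruenceSubgroup.Gamma1 N, γ ∉ Γ' → (h : UpperHalfPlane → ℂ) ∣[k] γ = -h) ∧
        ∀ τ : UpperHalfPlane, h τ ^ 2 = (Φ₁ τ - ((x₁ : ℚ) : ℂ) * G₁ τ) * G₁ τ := by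
  intro W₁ _ _ N _ f hW₁ L₁ _hL₁ c₁ hc₁ hin x₁ lam _hlam _hlam2 hwp Γ' hΓ g hg1 hg2 hg3 k G₁ Φ₁ hG0 hΦ
  have hf : f ≠ 0 := hW₁.1.ne_zero
  have hc₁' : (c₁ : ℂ) ≠ 0 := by exact_mod_cast hc₁
  obtain ⟨H, hHmd, hHeq, hHsq, hHslash⟩ :=
    exists_holomorphic_sqrt W₁ f hf L₁ c₁ hc₁ hin x₁ lam hwp g hg1 k G₁ Φ₁ hΦ
  -- periods of `Γ₁(N)` lie in `L₁`
  have hℓ : ∀ (γ : SL(2, ℤ)) (hγ : γ ∈ Gamma1 N),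
      (c₁ : ℂ) * cuspSymbol f ⟨γ, Gamma1_in_Gamma0 N hγ⟩ ∈ L₁.lattice := fun γ hγ ↦
    hin _ (cuspSymbol_mem_periodLatticeGamma1 f ⟨γ, hγ⟩)
  -- invariance under `Γ′`, anti-invariance under `Γ₁(N) ∖ Γ′`
  have hplus : ∀ γ : SL(2, ℤ), γ ∈ Γ' → H ∣[k] γ = H := by
    intro γ hγ'
    obtain ⟨hγ₀, hγ₁, kk, w, hw, heq⟩ := (hΓ γ).mp hγ'
    have h1 := hHslash γ hγ₁ 1 (fun v hv ↦ by
      rw [one_mul]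
      exact hg2 v _ hv (hℓ γ hγ₁) ⟨kk, w, hw, heq⟩)
    rwa [one_smul] at h1
  have hminus : ∀ γ ∈ Gamma1 N, γ ∉ Γ' → H ∣[k] γ = -H := by
    intro γ hγ₁ hγ'
    have hnot : ¬ ∃ kk : ℤ, ∃ m ∈ L₁.lattice,
        (c₁ : ℂ) * cuspSymbol f ⟨γ, Gamma1_in_Gamma0 N hγ₁⟩ = (kk : ℂ) * lam + 2 * m := by
      rintro ⟨kk, m, hm, heq⟩
      exact hγ' ((hΓ γ).mpr ⟨Gamma1_in_Gamma0 N hγ₁, hγ₁, kk, m, hm, heq⟩)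
    have h1 := hHslash γ hγ₁ (-1) (fun v hv ↦ by
      rw [neg_one_mul]
      exact hg3 v _ hv (hℓ γ hγ₁) hnot)
    rw [h1, neg_one_smul]
  -- cusp decay: `‖H∣A‖² = ‖(Φ₁ − x₁G₁)∣A‖·‖G₁∣A‖`
  have hzero : ∀ A : SL(2, ℤ), IsZeroAtImInfty (H ∣[k] A) := by
    intro A
    have ha : IsZeroAtImInfty (fun τ : ℍ ↦ ((⇑Φ₁) ∣[k] A) τ - ((x₁ : ℚ) : ℂ) * ((⇑G₁) ∣[k] A) τ) := by
      have h1 : IsZeroAtImInfty ((⇑Φ₁) ∣[k] A) := CuspFormClass.zero_at_infty_slash Φ₁ A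
      have h2 : IsZeroAtImInfty ((⇑G₁) ∣[k] A) := CuspFormClass.zero_at_infty_slash G₁ A
      have := h1.sub (h2.const_mul ((x₁ : ℚ) : ℂ))
      simpa [IsZeroAtImInfty, ZeroAtFilter] using this
    have hb : IsZeroAtImInfty ((⇑G₁) ∣[k] A) := CuspFormClass.zero_at_infty_slash G₁ A
    refine isZeroAtImInfty_of_norm_sq_eq (fun τ ↦ ?_) ha hb
    have hfac : ((⇑Φ₁) ∣[k] A) τ - ((x₁ : ℚ) : ℂ) * ((⇑G₁) ∣[k] A) τ =
        (Φ₁ (A • τ) - ((x₁ : ℚ) : ℂ) * G₁ (A • τ)) * denom A τ ^ (-k) := by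
      simp only [ModularForm.SL_slash_apply]; ring
    rw [hfac, ModularForm.SL_slash_apply, ModularForm.SL_slash_apply, norm_mul, norm_mul, norm_mul, mul_pow,
      ← norm_pow (H (A • τ)), hHsq (A • τ), norm_mul]
    ring
  -- the cusp form on `Γ′`
  let h : CuspForm Γ' k :=
    { toFun := H
      slash_action_eq' := fun A hA ↦ by
        obtain ⟨γ, hγ, rfl⟩ := hA
        exact hplus γ hγ
      holo' := hHmd
      zero_at_cusps' := fun {c} hc ↦ by
        have hc' : IsCusp c 𝒮ℒ := hc.mono (Subgroup.map_le_range _ _)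
        rw [OnePoint.isZeroAt_iff_forall_SL2Z hc']
        intro A _
        exact hzero A }
  have hcoe : (⇑h : ℍ → ℂ) = H := rfl
  refine ⟨h, ?_, fun γ hγ hγ' ↦ by rw [hcoe]; exact hminus γ hγ hγ', fun τ ↦ by rw [hcoe]; exact hHsq τ⟩
  -- `h ≠ 0`
  intro h0
  rw [hcoe] at h0
  have hΨ0 : ∀ τ : ℍ, (Φ₁ τ - ((x₁ : ℚ) : ℂ) * G₁ τ) * G₁ τ = 0 := fun τ ↦ by
    rw [← hHsq τ, h0, Pi.zero_apply, zero_pow two_ne_zero]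
  -- analytic factors on the connected half-plane
  set Hset : Set ℂ := {z : ℂ | 0 < z.im} with hHset
  have hconn : IsPreconnected Hset := convex_setOf_im_pos.isPreconnected
  have hGan : AnalyticOnNhd ℂ ((⇑G₁) ∘ ofComplex) Hset :=
    (UpperHalfPlane.mdifferentiable_iff.mp G₁.holo').analyticOnNhd isOpen_upperHalfPlaneSet
  have hΦan : AnalyticOnNhd ℂ ((⇑Φ₁) ∘ ofComplex) Hset :=
    (UpperHalfPlane.mdifferentiable_iff.mp Φ₁.holo').analyticOnNhd isOpen_upperHalfPlaneSet
  have hAan : AnalyticOnNhd ℂ (fun z ↦ Φ₁ (ofComplex z) - ((x₁ : ℚ) : ℂ) * G₁ (ofComplex z)) Hset :=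
    fun z hz ↦ (hΦan z hz).sub (analyticAt_const.mul (hGan z hz))
  rcases AnalyticOnNhd.eq_zero_or_eq_zero_of_mul_eq_zero hAan hGan
    (fun z hz ↦ by simpa using hΨ0 (ofComplex z)) hconn with hA | hB
  · -- `x_{W₁} ≡ x₁` off the poles: every `τ` has `u_f(τ) ∈ (2c₁)⁻¹L₁` or `G₁(τ) = 0`
    have h2c : ((2 * (c₁ : ℂ))⁻¹) ≠ 0 := inv_ne_zero (mul_ne_zero two_ne_zero hc₁')
    set L₃ : PeriodPair := L₁.mulLeft ((2 * (c₁ : ℂ))⁻¹) h2c with hL₃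
    have hmem₃ : ∀ v : ℂ, v ∈ L₃.lattice ↔ 2 * (c₁ : ℂ) * v ∈ L₁.lattice := by
      intro v; rw [hL₃, PeriodPair.mem_mulLeft_lattice, inv_inv]
    -- a point where `G₁ ≠ 0`
    obtain ⟨τ₁, hτ₁⟩ : ∃ τ : ℍ, G₁ τ ≠ 0 := by
      by_contra hcon
      push Not at hcon
      exact hG0 (funext fun τ ↦ hcon τ)
    have hS₁ : (Hset ∩ ((⇑G₁) ∘ ofComplex) ⁻¹' {0}).Countable := by
      have hconn' : IsConnected Hset := ⟨⟨Complex.I, by simp [hHset]⟩, hconn⟩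
      refine countable_inter_preimage_singleton_of_analyticOnNhd hGan hconn' (x := (τ₁ : ℂ)) τ₁.im_pos ?_
      simpa [ofComplex_apply] using hτ₁
    have hS₂ := countable_setOf_eichlerIntegral_mem_lattice f L₃ hf
    obtain ⟨z, hz⟩ := nonempty_diff_of_countable (hS₁.union hS₂)
    have hzH : 0 < z.im := hz.1
    have hGz : G₁ (ofComplex z) ≠ 0 := fun h0' ↦ hz.2 (Or.inl ⟨hz.1, h0'⟩)
    have huz : eichlerIntegral f (ofComplex z) ∉ L₃.lattice := fun h' ↦ hz.2 (Or.inr ⟨hz.1, h'⟩)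
    -- at `z` the pole condition fails too (`c₁u ∈ L₁ ⇒ 2c₁u ∈ L₁`)
    have hzL : (c₁ : ℂ) * eichlerIntegral f (ofComplex z) ∉ L₁.lattice := by
      intro h'
      apply huz
      rw [hmem₃, mul_assoc, two_mul]
      exact add_mem h' h'
    have hx : L₁.weierstrassP ((c₁ : ℂ) * eichlerIntegral f (ofComplex z)) = L₁.weierstrassP (lam / 2) := by
      have h1 := hA z hzH
      have h2 := hΦ (ofComplex z) hzL
      have h3 : (L₁.weierstrassP ((c₁ : ℂ) * eichlerIntegral f (ofComplex z)) - ((W₁.b₂ : ℚ) : ℂ) / 12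
          - ((x₁ : ℚ) : ℂ)) * G₁ (ofComplex z) = 0 := by
        rw [sub_mul, ← h2]; simpa using h1
      rcases mul_eq_zero.mp h3 with h4 | h4
      · linear_combination h4 - hwp
      · exact absurd h4 hGz
    -- `g(c₁u(z))² = 0`, so `℘(c₁u(z)) = ℘(λ/2)` gives `c₁u(z) ≡ ±λ/2`, i.e. `2c₁u(z) ∈ L₁`
    have hlam2 : lam / 2 ∉ L₁.lattice := _hlam2
    rcases (L₁.weierstrassP_eq_weierstrassP_iff hzL hlam2).mp hx with hm | hm
    · apply huz
      rw [hmem₃]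
      have : 2 * (c₁ : ℂ) * eichlerIntegral f (ofComplex z) =
          ((c₁ : ℂ) * eichlerIntegral f (ofComplex z) + lam / 2) +
            ((c₁ : ℂ) * eichlerIntegral f (ofComplex z) + lam / 2) - lam := by ring
      rw [this]
      exact sub_mem (add_mem hm hm) _hlam
    · apply huz
      rw [hmem₃]
      have : 2 * (c₁ : ℂ) * eichlerIntegral f (ofComplex z) =
          ((c₁ : ℂ) * eichlerIntegral f (ofComplex z) - lam / 2) +
            ((c₁ : ℂ) * eichlerIntegral f (ofComplex z) - lam / 2) + lam := by ring
      rw [this]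
      exact add_mem (add_mem hm hm) _hlam
  · -- `G₁ ≡ 0`: excluded
    apply hG0
    funext τ
    have := hB τ τ.im_pos
    simpa [ofComplex_apply] using this

end Summit.BirchSwinnertonDyer.BirchSwinnertonDyer.Theorems.DepletionAtTwo.KummerForm

end
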